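import Mathlib
import HarnessLib
import Summits.HubbardSuperconductivity.HubbardSuperconductivity.Theorems.KLProgrammeKLRegimeTwoVolumeTowerTruncOfPartsH0
import Summits.HubbardSuperconductivity.HubbardSuperconductivity.Theorems.KLProgrammeKLRegimeTwoVolumeTowerSmallnessOfLaws

/-!
# Route `KLProgramme` — crux K3, VL child `KLRegimeVolumeLimitV17F2` (stmt-HubbardSuperconductivity-20440), skeleton «cauchy» v11: `TowerDataTS` FROM THE LAWS
# WITH THE BASE (H6) AS A HYPOTHESIS (twin of `…TowerDataTSOfLaws.towerDataTS_of_laws` over `towerDataTS_of_partsH0`; seat hubbard-kl-k3c4-p1 g16; `--supports` 20440)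

Byte-identical to `towerDataTS_of_laws` (p635591) except that the base-transfer bundle `hdataT`, its scalars and the grid-data block are replaced by the ONE base
hypothesis `h0T` of `…TowerTruncOfPartsH0` (located «BASE-SRC-ROWS»: the transfer-row route to the base is dead; the base itself is a named input now).

* **`towerDataTS_of_lawsH0`**.

Proofs only; no definition.  Honest framing: a conditional constructor; nothing here asserts `h0T`, any stub, K3, VL or superconductivity.
[cite: BenfattoGiulianiMastropietro2006, §2.7-§2.9 and §3]
-/

noncomputable section

namespace Summit.HubbardSuperconductivity.HubbardSuperconductivity.Theorems.TwoVolumeSource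

set_option linter.dupNamespace false -- summit = problem name (single-conjunct summit), D-0017

open Finset Filter Topology Literature.MathematicalPhysics.QuantumLattice GrassmannAlgebra Literature.Probability.LatticeModels
  Literature.Probability.LatticeModels.BattleFederbush
open Summit.HubbardSuperconductivity.HubbardSuperconductivity.Theorems.KLRegimeSplit
open Summit.HubbardSuperconductivity.HubbardSuperconductivity.Theorems.KLProgrammeLegKernels
open Summit.HubbardSuperconductivity.HubbardSuperconductivity.Theorems.TwoPointAssembly
open Summit.HubbardSuperconductivity.HubbardSuperconductivity.Theorems.EngineV8
open Summit.HubbardSuperconductivity.HubbardSuperconductivity.Theorems.TwoVolumeDefect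

set_option maxHeartbeats 800000 in -- one large constructor application
/-- **`TowerDataTS β U μ t` FROM THE SCALE LAWS** (see the module docstring). [folklore: composition; cite: BenfattoGiulianiMastropietro2006, §2.7-§2.9 and §3] -/
theorem towerDataTS_of_lawsH0 (β U μ : ℝ) {t : ℝ} (ht0 : 0 ≤ t) (ht1 : t ≤ 1) (Mth : ℕ → ℕ → ℕ)
    -- constants per scale and their laws
    (Λ ΛT κ κf aW sW eW' cW cRb cCb δb A q : ℕ → ℝ) (NV : ℕ → ℕ → ℝ) (sE cR cC δ : ℕ → ℕ → ℝ) (kf cW₀ δb₀ r₀ : ℝ)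
    (hΛ : ∀ j, 0 < Λ j) (hΛmono : ∀ j, Λ (j + 1) ≤ Λ j) (hΛT : ∀ j, Λ j ≤ ΛT j)
    (hκ : ∀ j, 0 < κ j) (hκmono : ∀ j, κ (j + 1) ≤ κ j) (hκfge : ∀ j, κ j ≤ κf j) (hκf : ∀ j, κf j ≤ kf * κ j) (hkf : 1 ≤ kf)
    (haW : ∀ j, 0 ≤ aW j) (hsW : ∀ j, 0 ≤ sW j) (heW' : ∀ j, 0 ≤ eW' j) (hcW1 : ∀ j, 1 ≤ cW j) (hcW : ∀ j, cW j ≤ cW₀)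
    (hcRb : ∀ j, 0 ≤ cRb j) (hcCb : ∀ j, 0 ≤ cCb j) (hδb0 : ∀ j, 0 ≤ δb j) (hδb : ∀ j, δb j ≤ δb₀)
    (hr₀ : 8 * Real.exp 2 * (kf + 1) * (cW₀ + δb₀ + 1) ≤ r₀)
    -- the profile majorants and the two smallness inequalities per scale
    (hq : ∀ j, q j = 1 / (2 * (Real.exp 2 * (κ j + r₀ * κ j)) ^ 2))
    (hNV0 : ∀ j m, 0 ≤ NV j m) (hA0 : ∀ j, 0 ≤ A j) (hNV : ∀ j m, NV j m ≤ A j * q j ^ m)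
    (hS : ∀ j, j < nScales β → Real.exp 1 * (aW j + cRb j + cCb j + 1) * (42 * cW j + 4 * δb j + 8 * Real.exp 1) * A j ≤ κ j ^ 2 / 2)
    (hS' : ∀ j, j + 1 < nScales β →
      Real.exp 1 * (aW (j + 1) + cRb (j + 1) + cCb (j + 1) + 1) * (42 * cW (j + 1) + 4 * δb (j + 1) + 8 * Real.exp 1) * (4 * Real.exp 1 * A j) ≤ κ (j + 1) ^ 2 / 2)
    -- (H4) the mismatch rates
    (hmis : ∀ j L, 0 ≤ sE j L ∧ 0 ≤ cR j L ∧ 0 ≤ cC j L ∧ 0 ≤ δ j L ∧ cR j L ≤ cRb j ∧ cC j L ≤ cCb j ∧ δ j L ≤ δb j)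
    (hmis0 : ∀ j, Tendsto (sE j) atTop (𝓝 0) ∧ Tendsto (cR j) atTop (𝓝 0) ∧ Tendsto (cC j) atTop (𝓝 0) ∧ Tendsto (δ j) atTop (𝓝 0))
    -- (H5) the three bundles, eventually in `L`
    (hdata : ∀ᶠ L in atTop, ∀ (b M : ℕ) [NeZero L] [NeZero (b * L)] [NeZero M], Mth L b ≤ M →
      TowerVolumeDataTS L M β U μ (klFlowFrameU L M β U μ (nScales β + 1)) (nScales β) (imagTimeWeight β M) t Λ κ aW sW NV ∧
      TowerVolumeDataTS (b * L) M β U μ (klFlowFrameU (b * L) M β U μ (nScales β + 1)) (nScales β) (imagTimeWeight β M) t Λ κ aW sW NV ∧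
      TowerCrossData L b M β μ (klFlowFrameU L M β U μ (nScales β + 1)) (klFlowFrameU (b * L) M β U μ (nScales β + 1)) (nScales β) (imagTimeWeight β M)
      Λ κ aW sW eW' ΛT cW κf (fun j => sE j L) (fun j => cR j L) (fun j => cC j L) (fun j => δ j L))
    -- (H6) the BASE as a hypothesis (located «BASE-SRC-ROWS», p3 g18: the transfer-row route to it is dead; any route may supply it): the TRUNCATED keyed
    -- defect of the step-`0` states at the `2r_L`-deep pins, canonical radius `r_L = L/(4J+7)`, tends to zero uniformly in the instance
    (h0T : ∀ (k : ℕ) (η : ℝ), 0 < η → ∀ᶠ L in atTop, ∀ (b M : ℕ) [NeZero L] [NeZero (b * L)] [NeZero M], Mth L b ≤ M →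
      ∀ (p : Fin k) (w : SrcLabel (b * L) M 0),
        (∀ i, 2 * (L / (4 * nScales β + 7)) ≤ (w.1.1.2 i).val % L ∧ (w.1.1.2 i).val % L + 2 * (L / (4 * nScales β + 7)) < L) →
        klKeyedDefectT L b M β U μ (klFlowFrameU L M β U μ (nScales β + 1)) (klFlowFrameU (b * L) M β U μ (nScales β + 1)) 0 k p w ≤ imagTimeWeight β M * η)
 :
    Nonempty (TowerDataTS β U μ t) := by
  have hκf0 : ∀ j, 0 < κf j := fun j => (hκ j).trans_le (hκfge j)
  obtain ⟨ρ₀, NS, ν₀, ν₁, ν₂, ν₃, ν₄, ν₅, νE, ν₆, ν₇, ν₈, hρ₀, hNSnn, hNS0, hNSsucc, hsm⟩ :=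
    towerSmallness_of_laws (nScales β) κ κf aW cW cRb cCb δb A q NV kf cW₀ δb₀ r₀ hκ hκmono hκfge hκf hkf haW hcW1 hcW hcRb hcCb hδb0 hδb hr₀ hq hNV0 hA0 hNV
      hS hS'
  exact towerDataTS_of_partsH0 β U μ ht0 ht1 Mth Λ κ aW sW κ aW sW eW' ΛT cW κf cRb cCb δb ρ₀ κ κ κ κ ν₀ ν₁ ν₂ ν₃ ν₄ ν₅ νE ν₆ ν₇ ν₈ NV NS sE cR cC δ
    hΛ hΛmono hΛT (fun j => ⟨hκ j, hκ j, hκf0 j⟩) (fun j => ⟨haW j, haW j, hsW j, hsW j, heW' j, zero_le_one.trans (hcW1 j), hδb0 j⟩)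
    (fun j => ⟨hρ₀ j, hκ j, hκ j, hκ j, hκ j⟩) hNV0 hNSnn hNS0 hNSsucc hsm hmis hmis0 hdata
    h0T

end Summit.HubbardSuperconductivity.HubbardSuperconductivity.Theorems.TwoVolumeSource

end
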